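import Literature.NumberTheory.LFunctions.Zhang2022.Section12LogFreeContour
import Literature.NumberTheory.LFunctions.Zhang2022.Section8Lemma84Estimate
import HarnessLib

/-!
# Zhang (2022) §12: the log-free twisted sum of the middle range — the contour argument for the
# manuscript's objects, explicit pieces (`Lemma84.logfree_core`)

Topic `Literature/NumberTheory/LFunctions/Zhang2022` (Landau–Siegel audit tree; verdict-neutral).
Y. Zhang, *Discrete mean estimates and the Landau–Siegel zero*, arXiv:2211.02515v1 (2022)
[Zhang2022LandauSiegel] — **an unrefereed manuscript under adjudication; nothing here asserts or
denies its Theorems 1–2, and no claim about Landau–Siegel zeros is made.** Lane ZHANG-L (strike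
seat zl-closer-3), leaf `Typed.Sec12C.Mid1225 c′` (§12 p.71; reduced by the tree's
`Typed.Sec12C.mid1225_of_logfree` to a bound for the log-free sharp twisted sum
`Σ_{l<Y} χ(l)ξ₀ⱼ(l;d,r)l^{β₆−1}`, `Y = P″₂/dr`; the underlying (12.11) has no proof in print,
tex L3549, GAP row G-L3t5-2).

This file instantiates the generic difference-contour inequality `Lemma84.norm_sum_log_diff_le`
(`Section12LogFreeContour`) with the manuscript's objects EXACTLY as the tree's
`Lemma84.lemma84_core` instantiates `norm_sum_log_sub_main_le`: coefficients
`χ(n)ξ₀ⱼ(n;d,r)n^{β_μ−1}` (`Section8Lemma84Coeff`), the continuation `𝔲 = U` of Lemma 8.3 (relative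
form, as hypotheses), the exceptional zero with MV's zero-free package, Lemma 5.8 on the small
rectangle through `Lemma84.norm_Phi_sub_model_le` — which here only serves to bound `|Φ|` on `∂R_s` by
`Δ + 4e^{9/2}(1+𝓛)𝓛·Π̂²K²α` (model value `|L′(1,χ)Π(d,r)(s+β_{j+1})(s+β_{j+2})/s| ≤
2e^{9/2}(1+𝓛)𝓛·Π̂²·(Kα)²/(α/2)`). Output (`logfree_core`): for `T < y′ ≤ y`, `log y − log y′ ≤ 1`,
`‖Σ_{n≤y} a(n)log(y/n) − Σ_{n≤y′} a(n)log(y′/n)‖ ≤` the four explicit pieces of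
`norm_sum_log_diff_le` with `M_R, M_l, M_h` as in `lemma84_core`. No residue and no main term occur.

Theorems only; no new definitions, no facts; standard axioms.

## References

* Y. Zhang, arXiv:2211.02515v1 (2022), §12 (12.11) p.70; §8 Lemma 8.4 (proof) p.47, Lemma 8.3,
  §5 Lemmas 5.5, 5.8. [cite: Zhang2022LandauSiegel, §12 (12.11) p.70; §8 Lemma 8.4]
* H. L. Montgomery, R. C. Vaughan, *Multiplicative Number Theory I*, CUP 2007, §6.2, Thm 11.4.
  [cite: MontgomeryVaughan2007, Thm 11.4]
-/

noncomputable section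

open Complex Real Set Finset

namespace Literature.NumberTheory.LFunctions.Zhang2022.Lemma84

open Skeleton Literature.Analysis.Complex

section Core

variable {D : ℕ} [NeZero D] (χ : DirichletCharacter ℂ D) (c' : ℝ)

/-- **The model value on `∂R_s` is `O(αΠ̂²|L′(1,χ)|)`**: for a boundary point `u` of the small
rectangle (`α/2 ≤ |u − β_μ| ≤ 7α/2`), `K ≥ 7 + 15|c′|`, `𝓛 ≥ 3`:
`‖L′(1,χ)Π(d,r)(u+β_{j+1}−β_μ)(u+β_{j+2}−β_μ)/(u−β_μ)‖ ≤ 2e^{9/2}(1+𝓛)𝓛·Π̂²·2K²α`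
(`|L′(1,χ)| ≤ 2e^{9/2}(1+𝓛)𝓛`, Lemma 3.1; `‖Π(d,r)‖ ≤ Π̂²`).
[cite: Zhang2022LandauSiegel, §8 Lemma 8.4 (proof); §3 Lemma 3.1] -/
theorem norm_model_bdry_le (hprim : χ.IsPrimitive) (h𝓛 : 3 ≤ Real.log D) (j μ : ℕ) {d r : ℕ}
    (hd : d ≠ 0) (hr : r ≠ 0) {K : ℝ} (hK : 7 + 15 * |c'| ≤ K) {u : ℂ}
    (hre : u.re ∈ Icc (-(alpha D / 2)) (alpha D / 2))
    (him : u.im ∈ Icc ((betaMu D μ).im - 3 * alpha D) ((betaMu D μ).im + 3 * alpha D))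
    (hbd : |u.re| = alpha D / 2 ∨ |u.im - (betaMu D μ).im| = 3 * alpha D) :
    ‖deriv χ.LFunction 1 * PiW χ d r * (u + (betaJ c' D (j + 1) - betaMu D μ)) *
        (u + (betaJ c' D (j + 2) - betaMu D μ)) / (u - betaMu D μ)‖ ≤
      (2 * Real.exp (9 / 2) * (1 + Real.log D) * Real.log D) *
        (∏ q ∈ (d * r).primeFactors, (1 - (q : ℝ)⁻¹)⁻¹) ^ 2 * (2 * K ^ 2 * alpha D) := by
  set α : ℝ := alpha D with hαdef
  set βμ : ℂ := betaMu D μ with hβμdef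
  set hatPi : ℝ := ∏ q ∈ (d * r).primeFactors, (1 - (q : ℝ)⁻¹)⁻¹ with hhatPi
  have hℓ2 : 2 ≤ ell D := by rw [ell]; linarith
  have hα0 : 0 < α := alpha_pos' (by linarith)
  have hαℓ : α * ell D ≤ 1 := alpha_mul_ell_le_one hℓ2
  have hβμre : βμ.re = 0 := betaMu_re D μ
  obtain ⟨hs_lo, hs_hi⟩ := small_rect_s_bounds hα0 hβμre hre him hbd
  have hβ : ∀ i : ℕ, ‖betaJ c' D i‖ ≤ 3 * α * (1 + 5 * |c'|) := by
    intro i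
    have h := norm_betaJ_le c' D i hα0.le (by linarith : 0 ≤ ell D)
    refine h.trans ?_
    have : 5 * |c'| * alpha D * ell D ≤ 5 * |c'| := by
      calc 5 * |c'| * alpha D * ell D = 5 * |c'| * (alpha D * ell D) := by ring
        _ ≤ 5 * |c'| * 1 := by gcongr
        _ = 5 * |c'| := mul_one _
    rw [← hαdef] at this ⊢
    nlinarith [abs_nonneg c']
  have hAK : ‖u + (betaJ c' D (j + 1) - βμ)‖ ≤ K * α := by
    have : u + (betaJ c' D (j + 1) - βμ) = (u - βμ) + betaJ c' D (j + 1) := by ring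
    rw [this]
    calc ‖(u - βμ) + betaJ c' D (j + 1)‖ ≤ ‖u - βμ‖ + ‖betaJ c' D (j + 1)‖ := norm_add_le _ _
      _ ≤ 7 * α / 2 + 3 * α * (1 + 5 * |c'|) := add_le_add hs_hi (hβ _)
      _ ≤ K * α := by nlinarith [abs_nonneg c']
  have hBK : ‖u + (betaJ c' D (j + 2) - βμ)‖ ≤ K * α := by
    have : u + (betaJ c' D (j + 2) - βμ) = (u - βμ) + betaJ c' D (j + 2) := by ring
    rw [this]
    calc ‖(u - βμ) + betaJ c' D (j + 2)‖ ≤ ‖u - βμ‖ + ‖betaJ c' D (j + 2)‖ := norm_add_le _ _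
      _ ≤ 7 * α / 2 + 3 * α * (1 + 5 * |c'|) := add_le_add hs_hi (hβ _)
      _ ≤ K * α := by nlinarith [abs_nonneg c']
  have hPi : ‖PiW χ d r‖ ≤ hatPi ^ 2 := norm_PiW_le_prodInv χ hd hr
  have hℓle : ‖deriv χ.LFunction 1‖ ≤ 2 * Real.exp (9 / 2) * (1 + Real.log D) * Real.log D :=
    Lemma31.norm_deriv_LFunction_le_near_one χ h𝓛 hprim (w := 1)
      (by rw [sub_self, norm_zero]; positivity)
  have hK0 : 0 ≤ K := by linarith [abs_nonneg c']
  have hs0 : 0 < ‖u - βμ‖ := lt_of_lt_of_le (by positivity) hs_lo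
  rw [norm_div, norm_mul, norm_mul, norm_mul, div_le_iff₀ hs0]
  calc ‖deriv χ.LFunction 1‖ * ‖PiW χ d r‖ * ‖u + (betaJ c' D (j + 1) - βμ)‖ *
        ‖u + (betaJ c' D (j + 2) - βμ)‖
      ≤ (2 * Real.exp (9 / 2) * (1 + Real.log D) * Real.log D) * hatPi ^ 2 * (K * α) * (K * α) := by
        gcongr
    _ = (2 * Real.exp (9 / 2) * (1 + Real.log D) * Real.log D) * hatPi ^ 2 * (2 * K ^ 2 * α) *
          (α / 2) := by ring
    _ ≤ (2 * Real.exp (9 / 2) * (1 + Real.log D) * Real.log D) * hatPi ^ 2 * (2 * K ^ 2 * α) *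
          ‖u - βμ‖ := by gcongr

set_option maxHeartbeats 800000 in
/-- **The log-free core for the manuscript's objects, explicit pieces.** Same hypotheses as
`Lemma84.lemma84_core` (χ ≠ χ₀ primitive, `𝓛 ≥ 3`, (A), the relative Lemma-8.3 data for `U`,
`0 < α ≤ η ≤ 1/40`, the `L`-bounds `B_L`, the zero-free package `M_inv` around the exceptional zero
`ρ ∈ [1 − η/2, 1)`, `ρ > 1 − α/2`, `0 < ℓ₀ ≤ |L′(1,χ)|`, `K ≥ 7 + 15|c′|`, `Kπ ≤ 𝓛⁸`,
`(1+16e^{9/2}π²K²)𝓛⁻¹⁵ ≤ ℓ₀α/4`), at TWO points `T < y′ ≤ y` with `log y − log y′ ≤ 1`: the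
difference of the two logarithmic Riesz means of `a(n) = χ(n)ξ₀ⱼ(n;d,r)n^{β_μ−1}` is at most
`(2π)⁻¹(4e^{αL}M_U((1+α)/α)³/D + 2e^{−ηL′}M_UB_L²M_inv(1+2/η)π/η + 4(α+η)e^{αL}·3M_UB_L²M_inv/D²
 + 672(L−L′)e^{αL/2}(Δ + 2e^{9/2}(1+𝓛)𝓛·Π̂²·2K²α))`, `L = log y`, `L′ = log y′`, `Δ` the bound of
`norm_Phi_sub_model_le`. [cite: Zhang2022LandauSiegel, §12 (12.11) p.70; §8 Lemma 8.4 (proof)]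
[cite: MontgomeryVaughan2007, §6.2, Thm 11.4] -/
theorem logfree_core (hχ1 : χ ≠ 1) (hprim : χ.IsPrimitive) (h𝓛 : 3 ≤ Real.log D)
    (hA : ‖χ.LFunction 1‖ ≤ 1 / Real.log D ^ 2022) (j μ : ℕ) {d r : ℕ} (hd : d ≠ 0) (hr : r ≠ 0)
    {y y' : ℝ} (hy'T : bigT D < y') (hyy' : y' ≤ y) (hlog1 : Real.log y - Real.log y' ≤ 1)
    (U : ℂ → ℂ) {ρ η MU BL Minv C₈₃ K ℓ₀ : ℝ}
    (hUd : DifferentiableOn ℂ U {s : ℂ | 9 / 10 < s.re})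
    (hU1 : ∀ s : ℂ, 1 < s.re → U s = χ.LFunction s /
      (χ.LFunction (s + betaJ c' D (j + 1)) * χ.LFunction (s + betaJ c' D (j + 2))) *
        xiSeries c' χ j d r s)
    (hMU : 0 ≤ MU) (hU : ∀ w : ℂ, 1 - η ≤ w.re → ‖U w‖ ≤ MU) (hC₈₃ : 0 ≤ C₈₃)
    (hU3 : ∀ s : ℂ, ‖s - 1‖ ≤ 5 * alpha D → ‖U s - PiW χ d r‖ ≤
      C₈₃ * (ell D ^ 8)⁻¹ * ∏ q ∈ (d * r).primeFactors, (1 - (q : ℝ)⁻¹)⁻¹)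
    (hαη : alpha D ≤ η) (hη40 : η ≤ 1 / 40) (hBL : 0 ≤ BL)
    (hL : ∀ s : ℂ, 1 - η ≤ s.re → ‖s‖ ≤ (D : ℝ) + 4 → ‖χ.LFunction s‖ ≤ BL) (hMinv : 0 ≤ Minv)
    (hpack : ∀ s : ℂ, 1 - 2 * η ≤ s.re → |s.im| ≤ (D : ℝ) + 1 → s ≠ (ρ : ℂ) →
      χ.LFunction s ≠ 0 ∧ ‖(χ.LFunction s)⁻¹‖ ≤ Minv * (1 + ‖s - ρ‖⁻¹))
    (hρ1 : ρ < 1) (hρη : 1 - η / 2 ≤ ρ) (hρα : 1 - alpha D / 2 < ρ) (hLρ : χ.LFunction ρ = 0)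
    (hL'ρ : deriv χ.LFunction ρ ≠ 0) (hℓ₀ : 0 < ℓ₀) (hℓ : ℓ₀ ≤ ‖deriv χ.LFunction 1‖)
    (hK : 7 + 15 * |c'| ≤ K) (hKL : K * π ≤ Real.log D ^ 8)
    (hE : (1 + 16 * Real.exp (9 / 2) * π ^ 2 * K ^ 2) / Real.log D ^ 15 ≤ ℓ₀ * alpha D / 4) :
    ‖(∑ n ∈ Finset.Ioc 0 ⌊y⌋₊,
          (χ (n : ZMod D) * xiZero c' D j n d r * (n : ℂ) ^ (betaMu D μ - 1)) *
            (Real.log (y / n) : ℂ)) -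
        ∑ n ∈ Finset.Ioc 0 ⌊y'⌋₊,
          (χ (n : ZMod D) * xiZero c' D j n d r * (n : ℂ) ^ (betaMu D μ - 1)) *
            (Real.log (y' / n) : ℂ)‖ ≤
      1 / (2 * π) * (4 * (Real.exp (alpha D * Real.log y) * (MU * ((1 + alpha D) / alpha D) ^ 3) / D) +
        2 * (Real.exp (-η * Real.log y') * (MU * BL * BL * (Minv * (1 + 2 / η))) * (π / η)) +
        4 * ((alpha D + η) * (Real.exp (alpha D * Real.log y) * (MU * BL * BL * (Minv * 3)) /
          (D : ℝ) ^ 2)) +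
        672 * (Real.log y - Real.log y') * Real.exp (alpha D * Real.log y / 2) *
          ((∏ q ∈ (d * r).primeFactors, (1 - (q : ℝ)⁻¹)⁻¹) ^ 2 *
              ((1 + 16 * Real.exp (9 / 2) * π ^ 2 * K ^ 2) / Real.log D ^ 15) * (24 * K ^ 2 + 2 * K) +
            32 * K ^ 3 * (C₈₃ * (ell D ^ 8)⁻¹ * ∏ q ∈ (d * r).primeFactors, (1 - (q : ℝ)⁻¹)⁻¹) *
              (2 * Real.exp (9 / 2) * (1 + Real.log D) * Real.log D) * alpha D +
            (2 * Real.exp (9 / 2) * (1 + Real.log D) * Real.log D) *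
              (∏ q ∈ (d * r).primeFactors, (1 - (q : ℝ)⁻¹)⁻¹) ^ 2 * (2 * K ^ 2 * alpha D))) := by
  set α : ℝ := alpha D with hαdef
  set βμ : ℂ := betaMu D μ with hβμdef
  set βa : ℂ := betaJ c' D (j + 1) with hβadef
  set βb : ℂ := betaJ c' D (j + 2) with hβbdef
  have hℓ2 : 2 ≤ ell D := by rw [ell]; linarith
  have hα0 : 0 < α := alpha_pos' (by linarith)
  have hη0 : 0 < η := lt_of_lt_of_le hα0 hαη
  have hαℓ : α * ell D ≤ 1 := alpha_mul_ell_le_one hℓ2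
  have hα1 : α ≤ 1 := by
    have h1 : 1 ≤ ell D := by linarith
    nlinarith
  have hβμre : βμ.re = 0 := betaMu_re D μ
  have hβare : βa.re = 0 := betaJ_re c' D _
  have hβbre : βb.re = 0 := betaJ_re c' D _
  obtain ⟨hβμ1, hβμ2⟩ := betaMu_im_bounds D μ hα0.le
  rw [← hβμdef, ← hαdef] at hβμ1 hβμ2
  have hβμn : ‖βμ‖ ≤ 1 / 2 := by
    rw [norm_betaMu D μ hα0.le, ← hβμdef]
    have : η ≤ 1 / 40 := hη40
    nlinarith
  have hβn : ∀ i : ℕ, ‖betaJ c' D i‖ ≤ 1 := by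
    intro i
    have h := norm_betaJ_le c' D i hα0.le (by linarith : 0 ≤ ell D)
    refine h.trans ?_
    have h1 : 5 * |c'| * alpha D * ell D ≤ 5 * |c'| := by
      calc 5 * |c'| * alpha D * ell D = 5 * |c'| * (alpha D * ell D) := by ring
        _ ≤ 5 * |c'| * 1 := by gcongr
        _ = 5 * |c'| := mul_one _
    have hKα : K * α ≤ 1 := by
      rw [hαdef, alpha_eq]
      have h9 : Real.log D ^ 9 = Real.log D ^ 8 * Real.log D := by ring
      rw [mul_div_assoc', div_le_one (by positivity), h9]
      calc K * π ≤ Real.log D ^ 8 := hKL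
        _ = Real.log D ^ 8 * 1 := (mul_one _).symm
        _ ≤ Real.log D ^ 8 * Real.log D := by gcongr; linarith
    rw [← hαdef] at h1 ⊢
    nlinarith [abs_nonneg c']
  -- the integrand
  set Φ : ℂ → ℂ := fun u => U (1 - βμ + u) * χ.LFunction (1 - βμ + u + βa) *
    χ.LFunction (1 - βμ + u + βb) / χ.LFunction (1 - βμ + u) with hΦdef
  have hΦ : ∀ u, Φ u = U (1 - βμ + u) * χ.LFunction (1 - βμ + u + βa) *
      χ.LFunction (1 - βμ + u + βb) / χ.LFunction (1 - βμ + u) := fun u => rfl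
  set f : ℕ → ℂ := fun n => χ (n : ZMod D) * xiZero c' D j n d r * (n : ℂ) ^ (βμ - 1) with hfdef
  -- sizes of `y, y'`
  have hT1 : 1 < bigT D := by rw [bigT]; exact Real.one_lt_exp_iff.2 (by positivity)
  have hy'1 : 1 ≤ y' := by linarith
  have hy1 : 1 ≤ y := by linarith
  have hy0 : 0 < y := by linarith
  -- the three `Φ`-bounds
  have hPhiR : ∀ u : ℂ, α ≤ u.re → χ.LFunction (1 - βμ + u) ≠ 0 ∧
      ‖Φ u‖ ≤ MU * ((1 + α) / α) ^ 3 := fun u hu =>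
    norm_Phi_right_le χ U Φ βμ βa βb hα0 hβμre hβare hβbre hΦ hMU
      (fun w hw => hU w (by linarith)) hu
  have hPhiL : ∀ t : ℝ, |t| ≤ (D : ℝ) → ‖Φ (((-η : ℝ) : ℂ) + t * I)‖ ≤
      MU * BL * BL * (Minv * (1 + 2 / η)) := fun t ht =>
    norm_Phi_left_le χ U Φ βμ βa βb hη0 (by linarith) hβμre hβμn hβare (hβn _) hβbre (hβn _)
      hΦ hMU hU hBL hL hMinv hpack hρη ht
  have hD2 : (2 : ℝ) ≤ D := by
    have h3 : Real.exp 3 ≤ D := by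
      have hD0 : (0 : ℝ) < D := by
        rcases lt_or_ge 0 (D : ℝ) with h | h
        · exact h
        · have : Real.log (D : ℝ) ≤ 0 := by
            have : (D : ℝ) = 0 := le_antisymm h (Nat.cast_nonneg D)
            rw [this, Real.log_zero]
          linarith
      exact (Real.le_log_iff_exp_le hD0).1 h𝓛
    have : (2 : ℝ) ≤ Real.exp 3 := by
      have := Real.add_one_le_exp (3 : ℝ); linarith
    linarith
  have hPhiH : ∀ x' y'' : ℝ, -η ≤ x' → x' ≤ α → |y''| = (D : ℝ) →
      ‖Φ ((x' : ℂ) + y'' * I)‖ ≤ MU * BL * BL * (Minv * 3) := fun x' y'' h1 h2 h3 =>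
    norm_Phi_horiz_le χ U Φ βμ βa βb hη0 (by linarith) hα1 hD2 hβμre hβμn hβare (hβn _)
      hβbre (hβn _) hΦ hMU hU hBL hL hMinv hpack h1 h2 h3
  -- the zero-free box (strict form)
  have hzf : ∀ w : ℂ, 1 - 2 * η < w.re → |w.im| < (D : ℝ) + 1 → w ≠ ρ →
      χ.LFunction w ≠ 0 := fun w h1 h2 h3 => (hpack w h1.le h2.le h3).1
  -- the Dirichlet series
  have hf9 : LSeriesSummable f 9 :=
    LSeriesSummable_coeff c' χ j μ d r (u := 9) (by rw [Complex.re_ofNat]; norm_num)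
  have hfΦ : ∀ t : ℝ, LSeries f ((9 : ℝ) + t * I) = Φ ((9 : ℝ) + t * I) := by
    intro t
    have h9 : (8 : ℝ) < (((9 : ℝ) : ℂ) + t * I).re := by simp; norm_num
    rw [LSeries_coeff_eq_xiSeries c' χ j μ d r h9, hΦ]
    set w : ℂ := 1 - βμ + (((9 : ℝ) : ℂ) + t * I) with hw
    have hwre : w.re = 10 := by simp [hw, hβμre]; norm_num
    have hw1 : 1 < w.re := by rw [hwre]; norm_num
    have hne : ∀ β : ℂ, β.re = 0 → χ.LFunction (w + β) ≠ 0 := fun β hβ =>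
      (inv_LFunction_le_right χ (a := 9) (by norm_num) (s := w + β)
        (by simp [hwre, hβ]; norm_num)).1
    have hne0 : χ.LFunction w ≠ 0 := by
      have := hne 0 (by simp); rwa [add_zero] at this
    have hna := hne βa hβare
    have hnb := hne βb hβbre
    rw [hU1 w hw1]
    field_simp
  -- the small-rectangle supremum of `Φ`
  set hatPi : ℝ := ∏ q ∈ (d * r).primeFactors, (1 - (q : ℝ)⁻¹)⁻¹ with hhatPi
  set Δ : ℝ := hatPi ^ 2 * ((1 + 16 * Real.exp (9 / 2) * π ^ 2 * K ^ 2) / Real.log D ^ 15) *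
      (24 * K ^ 2 + 2 * K) + 32 * K ^ 3 * (C₈₃ * (ell D ^ 8)⁻¹ * hatPi) *
      (2 * Real.exp (9 / 2) * (1 + Real.log D) * Real.log D) * α with hΔdef
  set Mmod : ℝ := (2 * Real.exp (9 / 2) * (1 + Real.log D) * Real.log D) * hatPi ^ 2 *
      (2 * K ^ 2 * α) with hMmod
  have hhatPi0 : 0 ≤ hatPi := Finset.prod_nonneg fun q hq => by
    have hq2 : (2 : ℝ) ≤ q := by exact_mod_cast (Nat.prime_of_mem_primeFactors hq).two_le
    have : (q : ℝ)⁻¹ ≤ 1 / 2 := by rw [inv_eq_one_div]; gcongr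
    exact inv_nonneg.2 (by linarith)
  have hK0 : 0 ≤ K := by linarith [abs_nonneg c']
  have hlogD0 : 0 ≤ Real.log D := by linarith
  have hΔ0 : 0 ≤ Δ := by rw [hΔdef]; positivity
  have hMmod0 : 0 ≤ Mmod := by rw [hMmod]; positivity
  have hPhiC : ∀ u : ℂ, u.re ∈ Icc (-(α / 2)) (α / 2) →
      u.im ∈ Icc (βμ.im - 3 * α) (βμ.im + 3 * α) → (|u.re| = α / 2 ∨ |u.im - βμ.im| = 3 * α) →
      ‖Φ u‖ ≤ Δ + Mmod := by
    intro u hre him hbd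
    have hcmp := norm_Phi_sub_model_le χ c' hprim h𝓛 hA j μ hd hr U hC₈₃ hK hKL hℓ₀ hℓ hE hU3
      hre him hbd
    have hmod := norm_model_bdry_le χ c' hprim h𝓛 j μ hd hr hK hre him hbd
    rw [hΦ u]
    have htri := norm_le_norm_add_norm_sub'
      (U (1 - βμ + u) * χ.LFunction (1 - βμ + u + βa) * χ.LFunction (1 - βμ + u + βb) /
        χ.LFunction (1 - βμ + u))
      (deriv χ.LFunction 1 * PiW χ d r * (u + (βa - βμ)) * (u + (βb - βμ)) / (u - βμ))
    calc _ ≤ ‖deriv χ.LFunction 1 * PiW χ d r * (u + (βa - βμ)) * (u + (βb - βμ)) / (u - βμ)‖ +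
          ‖U (1 - βμ + u) * χ.LFunction (1 - βμ + u + βa) * χ.LFunction (1 - βμ + u + βb) /
              χ.LFunction (1 - βμ + u) -
            deriv χ.LFunction 1 * PiW χ d r * (u + (βa - βμ)) * (u + (βb - βμ)) / (u - βμ)‖ := by
          linarith [norm_sub_norm_le
            (U (1 - βμ + u) * χ.LFunction (1 - βμ + u + βa) * χ.LFunction (1 - βμ + u + βb) /
              χ.LFunction (1 - βμ + u))
            (deriv χ.LFunction 1 * PiW χ d r * (u + (βa - βμ)) * (u + (βb - βμ)) / (u - βμ))]
      _ ≤ Mmod + Δ := add_le_add hmod hcmp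
      _ = Δ + Mmod := add_comm _ _
  -- apply the generic difference bound
  have hmain := norm_sum_log_diff_le χ U Φ f βμ βa βb (x := y) (x' := y') (ρ := ρ) (η := η)
    (α := α) (T' := (D : ℝ)) (M_c := Δ + Mmod) hχ1 hUd hβμre hβμ1 hβμ2 hΦ hy'1 hyy' hlog1 hα0 hαη
    hη40 (by linarith) hρ1 hρα hLρ hL'ρ hzf hf9 hfΦ (by positivity) hPhiR (by positivity) hPhiL
    (by positivity) hPhiH (by positivity) hPhiC
  refine hmain.trans (le_of_eq ?_)
  rw [hΔdef, hMmod]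

end Core

end Literature.NumberTheory.LFunctions.Zhang2022.Lemma84
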